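import Summits.QuantumAdvantage.QuantumAdvantage.Theorems.CubicForrelationNearExactIsExactTwelveDigitClass
import Summits.QuantumAdvantage.QuantumAdvantage.Theorems.CubicForrelationNearExactIsExactTwelveDigitProfile

/-!
# Crux `CubicForrelation.NearExactIsExact` (stmt-QuantumAdvantage-14043) — n = 12: E1280 FROM FRAMES — the exact shape of what is left

Certificate seat `b2b-cforr-cert` (gen 33).  HONEST FRAMING: a kernel-checked packaging lemma (standard axioms) about cubic Boolean functions on
12 bits; it closes nothing by itself and is NOT summit progress.  It states precisely what the remaining paper conjecture must deliver.

* `tdr_e_ge_1280_of_frames`: let `g` be a type-O cubic on 12 bits with digit class `κ = [u ≡ ±1 (mod 8)]` (`e = #κ`).  If every non-zero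
  direction `a` comes with a number `N(a)` such that `#{x : κ x ≠ κ(x ⊕ a)} + N(a) ≥ 2048` (by `tdq_frame_card` a symplectic frame of size
  `h` for `D_aκ` gives `N(a) = 2^{11−h}`; such a frame of size `rank(ι_a C*)/2` exists, `C*` the matching dual of the cubic 3-graph of `g`,
  …TwelveDigitDualForm) and `Σ_{a≠0} N(a) ≤ 1202303`, then `e ≥ 1280` (`tdq_weight_window_of_profile` + `8 ∣ e`).
  With …TwelveDigitWeightReduction (`isolation_twelve_57_64_of_digit_weight`): if this hypothesis can be met for EVERY type-O cubic — this is
  CONJECTURE P of HOME/b2b-cforr-cert-g33/PLAN-N12-E1280.md (`Σ_{a≠0} 2^{11−rank(ι_a C*)/2} ≤ 837760` for the matching dual of every type-O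
  3-graph; 1.2·10⁶ random instances, kit j199270, no exception; the bound is attained by four disjoint triples, where it yields `e ≥ 1400`
  exactly) — then `θ₁₂ = 57/64`.

References: MacWilliams–Sloane (1977) Ch. 15.  Axioms: the standard three.
-/

set_option linter.dupNamespace false -- D-0017: single-problem summit ⇒ `QuantumAdvantage.QuantumAdvantage` by design

noncomputable section

namespace Summit.QuantumAdvantage.QuantumAdvantage.Theorems.CubicForrelation.NearExactIsExact

open Finset
open Literature.Computability.QuantumComplexity
open Literature.Computability.QuantumComplexity.BuzetChailloux (bxor zeroVec)
open Literature.Computability.QuantumComplexity.DerivativeWalsh (W)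

/-- **E1280 from frames.**  For a type-O cubic `g` on 12 bits: lower bounds `2048 ≤ #{D_aκ = 1} + N(a)` (`a ≠ 0`) for the derivatives of the
digit class `κ = [u ≡ ±1 (mod 8)]` with `Σ_{a≠0} N(a) ≤ 1202303` force `e = #κ ≥ 1280` (profile bound + `8 ∣ e`).  Packaging; NOT summit
progress. [this work] -/
theorem tdr_e_ge_1280_of_frames (g : (Fin (6 + 6) → Bool) → Bool) (u : (Fin (6 + 6) → Bool) → ℤ) (hg : IsDegLeFun 3 g)
    (hu : ∀ x, W (fun y => signOf (g y)) x = (2 : ℝ) ^ 4 * (u x : ℝ)) (hodd : ∀ x, Odd (u x))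
    (N : (Fin (6 + 6) → Bool) → ℕ)
    (hN : ∀ a : Fin (6 + 6) → Bool, a ≠ zeroVec →
      2048 ≤ #(univ.filter fun x : Fin (6 + 6) → Bool =>
        (decide (u x % 8 = 1 ∨ u x % 8 = 7) ^^ decide (u (bxor x a) % 8 = 1 ∨ u (bxor x a) % 8 = 7)) = true) + N a)
    (hP : ∑ a ∈ univ.erase zeroVec, N a ≤ 1202303) :
    1280 ≤ #(univ.filter fun x : Fin (6 + 6) → Bool => u x % 8 = 1 ∨ u x % 8 = 7) := by
  have h8 := tdw_e_mod8 g u hg hu hodd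
  have hwin := (tdq_weight_window_of_profile (fun x => decide (u x % 8 = 1 ∨ u x % 8 = 7)) N hN hP).1
  have hset : (univ.filter fun x : Fin (6 + 6) → Bool => decide (u x % 8 = 1 ∨ u x % 8 = 7) = true) =
      univ.filter fun x : Fin (6 + 6) → Bool => u x % 8 = 1 ∨ u x % 8 = 7 := by
    simp only [decide_eq_true_eq]
  rw [hset] at hwin
  omega

end Summit.QuantumAdvantage.QuantumAdvantage.Theorems.CubicForrelation.NearExactIsExact

end
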